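import Summits.Langlands.Langlands.Statement
import Summits.Langlands.Langlands.Theorems.DyadicOddResidueOddPrimesRegularFMOfXZhang
import Literature.NumberTheory.Automorphic.RamakrishnanTensorProductGL2
import Literature.NumberTheory.Automorphic.GLnAdelicStructureProofs
import HarnessLib

/-!
# `TensorGaloisToAutomorphicQ3_special` — F3 special-case instance (forward generator G4, generation 5)

The graded family `TensorGaloisToAutomorphicQ k` VERBATIM as in the skeleton `Lines/TensorGaloisToAutomorphicQ3.lean`
(same namespace; this file does not import the skeleton so that it elaborates on its own), the FLOOR `k = 2` PROVED
(`floor_two`: Fontaine–Mazur for `GL₂/ℚ` at odd `ℓ` — tree theorem `Theorems.oddPrimesRegularFM_of_XZhang2024_tateTwist`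
modulo the named fact `XZhang2024_fontaineMazurGL2_tateTwist` — composed with Ramakrishnan's Theorem M (i), the named
fact `Ramakrishnan2000_theoremM`: the tensor clause says `ρ(Frob_v)` has inverse-root data `{αᵢ βⱼ}`, which is the
Satake parameter of `π₁ ⊠ π₂`), and the F3 instance `example : TensorGaloisToAutomorphicQ 2` closing by `simpa using
floor_two …`.  No `sorry`.  The rung `k = 3` is the filed statement; the floor `k = 2` is its specialisation along
the tensor-length dial.
-/

noncomputable section

set_option linter.dupNamespace false

open scoped MatrixGroups Matrix NumberField Classical Polynomial
open Filter IsDedekindDomain Field Polynomial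
open Literature.NumberTheory.Automorphic Literature.NumberTheory.GaloisRepresentations
open Literature.NumberTheory.PAdicHodge
open Summit.Langlands

namespace Summit.Langlands.Langlands.Cruxes.ReciprocityUpToIrreducibility.TensorGaloisToAutomorphicQ3

/-- Iterated `satakeTensor` of a list of Satake parameters (`[α, β] ↦ {αᵢ βⱼ}`,
`[α, β, γ] ↦ {αᵢ βⱼ γₖ}`; the empty tensor product is the trivial parameter `{1}`). [folklore] -/
def satakeTensorFold : List (Multiset ℂ) → Multiset ℂ
  | [] => {1}
  | [α] => α
  | α :: β :: l => satakeTensor α (satakeTensorFold (β :: l))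

@[simp] theorem satakeTensorFold_pair (α β : Multiset ℂ) :
    satakeTensorFold [α, β] = satakeTensor α β := rfl

@[simp] theorem satakeTensorFold_triple (α β γ : Multiset ℂ) :
    satakeTensorFold [α, β, γ] = satakeTensor α (satakeTensor β γ) := rfl

/-- The `GL₂` FACTOR SECTOR (at `F = ℚ` verbatim the hypotheses of the tree item
`DyadicOddResidue.OddPrimesRegularFM`, stmt-Langlands-18743; stated for any number field so that the sector
predicate `InTensorSector` below makes sense at every `(F, n)`): `σ : Γ_F → GL₂(ℚ̄_ℓ)` irreducible, odd,
unramified at all but finitely many places, de Rham at every `v ∣ ℓ` for the PINNED Fontaine datum with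
distinct labelled Hodge–Tate weights. -/
def InOddRegularSectorGL2 {F : Type} [Field F] [NumberField F] {ℓ : ℕ} [Fact ℓ.Prime]
    (σ : Literature.NumberTheory.GaloisRepresentations.FramedGaloisRep F (PadicAlgCl ℓ) 2) : Prop :=
  σ.toGaloisRep.IsIrreducible ∧ σ.IsOdd ∧
    (∀ᶠ v : IsDedekindDomain.HeightOneSpectrum (NumberField.RingOfIntegers F) in Filter.cofinite,
      σ.IsUnramifiedAt v) ∧
    ∀ (v : IsDedekindDomain.HeightOneSpectrum (NumberField.RingOfIntegers F))
      (hv : ((ℓ : ℕ) : NumberField.RingOfIntegers F) ∈ v.asIdeal),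
      (Literature.NumberTheory.PAdicHodge.fontainePstAdicCompletion v ℓ hv).IsDeRhamFramed (σ.toLocal v) ∧
      ∀ τ : v.adicCompletion F →+* PadicAlgCl ℓ, Continuous τ →
        (σ.labelledHodgeTateWeightsAt v
          (Literature.NumberTheory.PAdicHodge.fontainePstAdicCompletion v ℓ hv).algebra
          (Literature.NumberTheory.PAdicHodge.fontainePstAdicCompletion v ℓ hv).𝔅 τ).Nodup

/-- **The TENSOR SECTOR at `(F, n, ℓ, ι)`** (used only by the merge / off-sector statements of the ladder
skeleton): `ℓ` odd, `n = 2 ^ k` with `k ≥ 2`, and `k` representations of the `GL₂` factor sector whose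
Frobenius characteristic polynomials tensor (through `ι`, a.e.) to those of `ρ`.  Degree-agnostic: the
tensor clause is a statement about characteristic polynomials, so no transport along `n = 2 ^ k` is needed. -/
def InTensorSector {F : Type} [Field F] [NumberField F] {ℓ : ℕ} [Fact ℓ.Prime] {n : ℕ}
    (ι : PadicAlgCl ℓ ≃+* ℂ)
    (ρ : Literature.NumberTheory.GaloisRepresentations.FramedGaloisRep F (PadicAlgCl ℓ) n) : Prop :=
  ℓ ≠ 2 ∧ ∃ k : ℕ, 2 ≤ k ∧ n = 2 ^ k ∧
    ∃ σ : Fin k → Literature.NumberTheory.GaloisRepresentations.FramedGaloisRep F (PadicAlgCl ℓ) 2,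
      (∀ i, InOddRegularSectorGL2 (σ i)) ∧
      ∀ᶠ v : IsDedekindDomain.HeightOneSpectrum (NumberField.RingOfIntegers F) in Filter.cofinite,
        ∀ α : Fin k → Multiset ℂ,
          (∀ i, (σ i).HasFrobCharpolyAt v
            (Literature.NumberTheory.Automorphic.arithFrobPolyOfSatake ι v.residueCard 1 (α i))) →
          ρ.HasFrobCharpolyAt v
            (Literature.NumberTheory.Automorphic.arithFrobPolyOfSatake ι v.residueCard 1
              (satakeTensorFold (List.ofFn α)))

/-- **The rung family** (dial = tensor length `k`, rank `2 ^ k`): clause (B) over `ℚ` at odd `ℓ`, in the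
a.e.-Satake form, for irreducible geometric `ρ : Γ_ℚ → GL_{2^k}(ℚ̄_ℓ)` whose Frobenius characteristic
polynomials are, at all but finitely many places, the tensor products (through `ι`) of those of `k`
representations `σ_i` of the `GL₂` factor sector — the unramified shadow of `ρ ≅ σ₁ ⊗ ⋯ ⊗ σ_k`.
Conclusion: an AUTOMORPHIC (Borel–Jacquet datum, not asserted cuspidal) `P` on `GL_{2^k}(𝔸_ℚ)` with
`SatakeFrobCompatibleAt ι Π ρ v` for almost all `v`. -/
def TensorGaloisToAutomorphicQ (k : ℕ) : Prop :=
  ∀ (ℓ : ℕ) [Fact ℓ.Prime], ℓ ≠ 2 → ∀ (ι : PadicAlgCl ℓ ≃+* ℂ)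
    (ρ : Literature.NumberTheory.GaloisRepresentations.FramedGaloisRep ℚ (PadicAlgCl ℓ) (2 ^ k))
    (σ : Fin k → Literature.NumberTheory.GaloisRepresentations.FramedGaloisRep ℚ (PadicAlgCl ℓ) 2),
    ρ.toGaloisRep.IsIrreducible →
    (∀ᶠ v : IsDedekindDomain.HeightOneSpectrum (NumberField.RingOfIntegers ℚ) in Filter.cofinite,
      ρ.IsUnramifiedAt v) →
    (∀ (v : IsDedekindDomain.HeightOneSpectrum (NumberField.RingOfIntegers ℚ))
      (hv : ((ℓ : ℕ) : NumberField.RingOfIntegers ℚ) ∈ v.asIdeal),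
      (Literature.NumberTheory.PAdicHodge.fontainePstAdicCompletion v ℓ hv).IsDeRhamFramed (ρ.toLocal v)) →
    (∀ i, InOddRegularSectorGL2 (σ i)) →
    (∀ᶠ v : IsDedekindDomain.HeightOneSpectrum (NumberField.RingOfIntegers ℚ) in Filter.cofinite,
      ∀ α : Fin k → Multiset ℂ,
        (∀ i, (σ i).HasFrobCharpolyAt v
          (Literature.NumberTheory.Automorphic.arithFrobPolyOfSatake ι v.residueCard 1 (α i))) →
        ρ.HasFrobCharpolyAt v
          (Literature.NumberTheory.Automorphic.arithFrobPolyOfSatake ι v.residueCard 1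
            (satakeTensorFold (List.ofFn α)))) →
    ∀ hcpt : Literature.NumberTheory.Automorphic.isCompact_glFiniteIntegralLevel (2 ^ k) ℚ,
      ∃ P : Literature.NumberTheory.Automorphic.AutomorphicRepData
          (Literature.NumberTheory.Automorphic.AutomorphyDatum.gl (2 ^ k) ℚ hcpt),
        ∀ᶠ v : IsDedekindDomain.HeightOneSpectrum (NumberField.RingOfIntegers ℚ) in Filter.cofinite,
          Summit.Langlands.SatakeFrobCompatibleAt ι P ρ v

/-- **THE RUNG** (the filed statement): the family at `k = 3` — `GL₂ × GL₂ × GL₂ → GL₈` reciprocity over `ℚ`. -/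
def TensorGaloisToAutomorphicQ3 : Prop := TensorGaloisToAutomorphicQ 3

section Floor

/-- **The floor of the ladder** (`k = 2`): Fontaine–Mazur for `GL₂/ℚ` at odd `ℓ` (tree theorem
`Theorems.oddPrimesRegularFM_of_XZhang2024_tateTwist`, item `DyadicOddResidue.OddPrimesRegularFM`) for the two
factors, then Ramakrishnan's Theorem M (i) (tree named fact `Ramakrishnan2000_theoremM`): the automorphic tensor
product `π₁ ⊠ π₂` on `GL₄(𝔸_ℚ)` has Satake parameters `{αᵢ βⱼ}` a.e., which is what the tensor clause says
`ρ(Frob_v)` has as inverse-root data. [cite: Ramakrishnan2000, Theorem M (§3)] [cite: XZhang2024FontaineMazurP3, Thm. 1.0.2] -/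
theorem floor_two (hXZ : XZhang2024_fontaineMazurGL2_tateTwist) (hM : Ramakrishnan2000_theoremM) :
    TensorGaloisToAutomorphicQ 2 := by
  intro ℓ _ hℓ ι ρ σ _hirr hunr _hdR hσ htensor hcpt
  have h2 : isCompact_glFiniteIntegralLevel 2 ℚ := isCompact_glFiniteIntegralLevel_holds 2 ℚ
  obtain ⟨π₀, -, hπ₀⟩ :=
    Summit.Langlands.Langlands.Theorems.oddPrimesRegularFM_of_XZhang2024_tateTwist hXZ ℓ hℓ (σ 0)
      (hσ 0).1 (hσ 0).2.1 (hσ 0).2.2.1 (hσ 0).2.2.2 h2 ι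
  obtain ⟨π₁, -, hπ₁⟩ :=
    Summit.Langlands.Langlands.Theorems.oddPrimesRegularFM_of_XZhang2024_tateTwist hXZ ℓ hℓ (σ 1)
      (hσ 1).1 (hσ 1).2.1 (hσ 1).2.2.1 (hσ 1).2.2.2 h2 ι
  obtain ⟨P, hP⟩ := (hM ℚ h2 hcpt π₀ π₁).1
  refine ⟨P, ?_⟩
  filter_upwards [hπ₀, hπ₁, hP, hunr, htensor] with v h0 h1 hPv hunrv htv
  obtain ⟨α, hα, -, hσ0⟩ := h0
  obtain ⟨β, hβ, -, hσ1⟩ := h1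
  refine ⟨satakeTensor α β, hPv α β hα hβ, hunrv, ?_⟩
  have hlist : List.ofFn ![α, β] = [α, β] := by
    simp [List.ofFn_succ]
  have hfold : satakeTensorFold (List.ofFn ![α, β]) = satakeTensor α β := by
    rw [hlist, satakeTensorFold_pair]
  have key : ρ.HasFrobCharpolyAt v
      (Literature.NumberTheory.Automorphic.arithFrobPolyOfSatake ι v.residueCard 1
        (satakeTensorFold (List.ofFn ![α, β]))) := by
    refine htv ![α, β] ?_
    intro i
    fin_cases i
    · simpa using hσ0
    · simpa using hσ1
  rw [hfold] at key
  exact key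

end Floor


/-- **F3 special-case instance**: the family at the floor parameter `k = 2` IS the floor (modulo the floor's two
named Literature facts, exactly as the tree proves the floor item). -/
example (hXZ : XZhang2024_fontaineMazurGL2_tateTwist) (hM : Ramakrishnan2000_theoremM) :
    TensorGaloisToAutomorphicQ 2 := by
  simpa [TensorGaloisToAutomorphicQ] using floor_two hXZ hM

/-- The floor restated with the facts as a conjunction (the skeleton's `stub_floorFacts` shape). -/
theorem floor_two' (h : XZhang2024_fontaineMazurGL2_tateTwist ∧ Ramakrishnan2000_theoremM) :
    TensorGaloisToAutomorphicQ 2 :=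
  floor_two h.1 h.2

end Summit.Langlands.Langlands.Cruxes.ReciprocityUpToIrreducibility.TensorGaloisToAutomorphicQ3

end
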